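import Summits.CriticalPhenomena.SAWScalingLimit.Theorems.SAWDefectDecoherenceMassRatioFlatRootGlue
import Summits.CriticalPhenomena.SAWScalingLimit.Theorems.SAWDefectDecoherenceMassRatioSwapArcPositive

/-!
# Crux `SAWDefectDecoherence.MassRatio` (stmt-CriticalPhenomena-8550) — the typed split along the
# necessity seam, kernel glue (registered sub-goal `MassRatio_of_subs`)

The strategy census of this crux (`Cruxes/MassRatio/STRATEGY-CENSUS.md`, crux-strategist p1) records
that every planned line at the filed cut `3/4` dies on the same residual: in the tame frame the crux is
the exponent inequality `q − p ≤ 3/4` between a certified boundary-arrival exponent `q` (Coulomb-gas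
value `2h_b = 5/4`) and a certified bulk-mass exponent `p` (value `h_b + x₁ = 35/48`). This file lands
the IMPLICATION from the three sub-statements of the canonical (flat-root, arc-averaged) form of that
seam to the crux BY NAME, over the predicates of `…FlatRootDefs` (p96567), so that a route split
`MassRatio ↦ {RootSwapArcAll, HalfDiscArcArrival (1/3), ArcRootedBulkMass (2/5)}` has its glue in the
tree:

* `Sub₁ = ∀ ε > 0, RootSwapArc ε` — change of root (exponent `0`; SAW boundary quasi-multiplicativity,
  open);
* `Sub₂ = HalfDiscArcArrival (1/3)` — far-arc arrival from the tame root inside the lattice half-disc,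
  `Σ_{a'∈S_δ} Z_{H_δ}(b_δ → a') ≥ c₀ δ^{1/3}` (prediction `δ^{1/4}`; rigorous today `δ^{1}`);
* `Sub₃ = ArcRootedBulkMass (2/5)` — arc-rooted normalised bulk mass `≤ C δ^{-2/5}` (prediction
  `δ^{-13/48}`; no polynomial bound is known).

Exponent bookkeeping: `2/5 + 1/3 = 11/15 < 3/4`, so `Glue.arcMassRatio_of_split` (p99446) gives
`ArcMassRatio (11/15)`, and `massRatio_of_flatRootStubs` (p99446; root swap used at `ε = 1/60`, arc
positivity LANDED as `ArcSwap.stub_swapArcPositive`, p96866) concludes `MassRatio`.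

Sources: `…FlatRootDefs/Glue.lean`, `…SwapArcPositive.lean`; H. Duminil-Copin, S. Smirnov, Ann. of
Math. 175 (2012) 1653–1665 (arXiv:1007.0575) for the observable. Deliberately NOT here: any of the
three sub-statements (open), and their written-out parameterless forms (they belong to the route file
if the planner files the split; see `Cruxes/MassRatio/SplitCertificate.lean` for the rfl bridges).
-/

noncomputable section

namespace Summit.CriticalPhenomena.SAWScalingLimit.Theorems.MassRatio.FlatRoot

open Literature.Probability.LatticeModels Literature.Probability.RandomPlanarGeometry
open Literature.Probability.RandomPlanarGeometry.SAW
open Summit.CriticalPhenomena.SAWScalingLimit.Theses.SAWDefectDecoherence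
open Summit.CriticalPhenomena.SAWScalingLimit.Theorems.MassRatio.Negative
open Summit.CriticalPhenomena.SAWScalingLimit.Theorems.MassRatio.Renewal (Z)
open scoped Classical

namespace Split

/-- Arc positivity at every datum, in the predicate form of `…FlatRootDefs`, from the LANDED stub
`ArcSwap.stub_swapArcPositive` (p96866) by uncurrying the frame. [folklore] -/
theorem swapArcPositive_all :
    ∀ (D : DobrushinDomain) (ρ : ℝ) (Λ : ℝ → Finset HexVertex) (m : ℝ → ℤ)
      (a b : ℝ → Sym2 HexVertex), SwapArcPositive D ρ Λ m a b := by
  intro D ρ Λ m a b hF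
  obtain ⟨hρ, hflat, hadm, hexh, ha, hb⟩ := hF
  exact ArcSwap.stub_swapArcPositive D ρ Λ m a b hρ hflat hadm hexh ha hb

/-- **The typed split of the crux (predicate form).** Root swap for every `ε > 0`, far-arc arrival at
exponent `1/3` and arc-rooted bulk mass at exponent `2/5` imply `MassRatio`: `2/5 + 1/3 = 11/15 < 3/4`
(`Glue.arcMassRatio_of_split`, then `massRatio_of_flatRootStubs` with the landed arc positivity).
[folklore] -/
theorem MassRatio_of_subs : (∀ ε : ℝ, 0 < ε → RootSwapArc ε) → HalfDiscArcArrival (1 / 3) → ArcRootedBulkMass (2 / 5) → MassRatio :=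
  fun hR hB hA =>
    massRatio_of_flatRootStubs hR
      ⟨11 / 15, by norm_num, Glue.arcMassRatio_of_split (A := 2 / 5) (B := 1 / 3) (by norm_num) hB hA⟩
      swapArcPositive_all

end Split

end Summit.CriticalPhenomena.SAWScalingLimit.Theorems.MassRatio.FlatRoot
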